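import Summits.HodgeConjecture.HodgeConjecture.Theorems.SoloInformedConiveauOne
import HarnessLib

/-!
# Under the Hodge conjecture Hodge classes are VERTICAL for every fibration of small fibre
# codimension; the Hodge conjecture as a statement about one fibration at a time

Family `hodge`; solo (informed) programme, third landing; companion to
`Theorems/SoloInformedConiveauOne` (`HodgeConjecture ↔ C1`: every rational `(p,p)`-class with
`2 ≤ p ≤ n/2` dies on a non-empty Zariski open subset) and
`Theorems/SoloInformedConiveauOneBirational` (`C1(n,p)` is a birational invariant).

`C1` asks, for a Hodge class `c` on `X`, for SOME divisor `D ⊂ X` with `c|_{X ∖ D} = 0`. This file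
records where the divisor may be looked for:

* `soloInformed_verticalSupport_of_hodgeConjecture` — **verticality.** If the Hodge conjecture holds,
  then for EVERY morphism `f : X ⟶ B` of smooth projective varieties (`dim X = n`, `dim B = m`) with
  `n < m + p` and every rational `(p,p)`-class `c` on `X` there is a proper Zariski-closed `T ⊊ B`
  with `c|_{X ∖ f⁻¹T} = 0`: an algebraic cycle of dimension `n - p < m` has proper closed image in
  `B` (closed maps do not raise the dimension of points, the tree's `le_coheight_of_mem_image`).
  For `p ≥ 2` this applies to every fibration of `X` in CURVES over an `(n-1)`-fold (generic linear
  projection of `X ⊂ ℙᴺ` from a general `ℙ^{N-n}`, after blowing up the `deg X` base points — a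
  birational modification, harmless by `SoloInformedConiveauOneBirational`): Hodge classes below
  and at the middle degree must die over a dense open subset of the base of the curve fibration,
  i.e. on a neighbourhood `f⁻¹(B°)` of the generic curve.
* `soloInformed_coniveauOne_of_verticalSupport` — conversely, dying off `f⁻¹T` for a SURJECTIVE
  `f` and a proper closed `T ⊊ B` is coniveau `≥ 1`.
* `soloInformed_hodgeConjecture_iff_verticalSupport` — **the fibration form of the Hodge
  conjecture**: `HodgeConjecture ↔` for all smooth projective `X`, all `2 ≤ p ≤ n/2`, all rational
  `(p,p)`-classes `c` and ALL morphisms `f : X ⟶ B` to smooth projective `B` with `n < dim B + p`,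
  `c` dies off the preimage of a proper closed subset of `B` (granted the named facts of the companion
  file). The instance `f = 𝟙 X` is `C1` itself, so the equivalence is elementary; its content is
  the necessity of verticality for every OTHER such `f`, which for the generic-projection curve
  fibration `f : X̃ ⟶ ℙ^{n-1}` turns `C1` into the vanishing of ONE class: by Deligne's degeneration
  of the Leray spectral sequence of the smooth part and Artin vanishing on the affine base, `c` dies
  on `f⁻¹(B°)` for some dense open `B° ⊂ ℙ^{n-1}` iff its Leray component
  `ξ₁(c) ∈ colim_{B°} H^{2p-1}(B°, R¹f_*ℚ)` vanishes (the `R⁰`- and `R²`-components are carried by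
  `H^*(ℙ^{n-1})` and die off a hyperplane) — the cohomology of the function field
  `ℂ(t₁, …, t_{n-1})` with coefficients in `H¹` of the generic curve section, i.e. in the rational
  Tate module of its Jacobian. For `p = 1` this is Lefschetz's proof of the `(1,1)` theorem
  (`H¹(B°, R¹)`: normal functions, Jacobi inversion); for `(n, p) = (4, 2)` it is a class in
  `H³(ℂ(t₁,t₂,t₃), V J_η)`, top degree for a field of cohomological dimension `3`. (This last
  paragraph is the programme's reading of the theorem, not formalised here.)

## References

* [GrothendieckTopology1969] A. Grothendieck, Hodge's general conjecture is false for trivial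
  reasons, Topology 8 (1969), pp. 300–301.
* S. Lefschetz, L'analysis situs et la géométrie algébrique, Gauthier-Villars 1924 (Poincaré
  normal functions; the `(1,1)` theorem via pencils of curves) — as presented in [VoisinHodgeII2003],
  Ch. 8.
* [Zucker1979] S. Zucker, Hodge theory with degenerating coefficients, Ann. of Math. 109 (1979)
  (the theorem on normal functions over curves).
* [VoisinHodgeII2003] C. Voisin, Hodge Theory and Complex Algebraic Geometry II, CUP 2003, Ch. 8
  (normal functions and the Leray filtration).
* [Hartshorne1977] R. Hartshorne, Algebraic Geometry, II Ex. 3.20, Ex. 3.22 (dimension of images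
  and fibres).
-/

open CategoryTheory AlgebraicGeometry
open Literature.AlgebraicTopology.SingularHomology
open Literature.AlgebraicGeometry Literature.AlgebraicGeometry.HodgeTheory

namespace Summit.HodgeConjecture.HodgeConjecture.Theorems

variable {n m : ℕ} {X B : Motives.SchemeOver ℂ}

/-- **An algebraic class of codimension `p` is vertical for every morphism with `n < m + p`.**
For `f : X ⟶ B` a morphism of smooth projective varieties of dimensions `n`, `m` with `n < m + p`,
every class in `algebraicClasses X p = Nᵖ H²ᵖ(X(ℂ); ℂ)` dies off `f⁻¹T` for a proper Zariski-closed
`T ⊊ B`: it dies off a closed `Z` of codimension `≥ p`, and `T = f(Z)` is closed (`f` is proper)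
with points of codimension `≥ 1` (`le_coheight_of_mem_image`: `1 + n ≤ m + p`).
[cite: GrothendieckTopology1969, §1] [cite: Hartshorne1977, II Ex. 3.20 and Ex. 4.4] -/
theorem soloInformed_verticalSupport_of_mem_algebraicClasses (hX : Motives.IsSmoothProjective n X)
    (hB : Motives.IsSmoothProjective m B) (f : X ⟶ B) {p : ℕ} (hnmp : n < m + p)
    {c : complexBetti X (2 * p)} (hc : c ∈ algebraicClasses X p) :
    ∃ T : Set B.left, IsClosed T ∧ T ≠ Set.univ ∧
      complexBetti.restrictCompl X (f.left.base ⁻¹' T) (2 * p) c = 0 := by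
  have hf : IsClosedMap f.left.base :=
    haveI := isProper_left_of_isSmoothProjective hX hB f
    f.left.isClosedMap
  obtain ⟨Z, hZc, hZp, hcZ⟩ := exists_support_of_mem_supportedClasses hc
  refine ⟨f.left.base '' Z, hf _ hZc, ?_, ?_⟩
  · exact soloInformed_ne_univ_of_one_le_coheight hB
      (fun x hx ↦ le_coheight_of_mem_image hX hB f hf hZp (s := 1) (by omega) hx)
  · exact complexBetti.restrictCompl_eq_zero_of_subset (Set.subset_preimage_image _ _) hcZ

/-- **Verticality of Hodge classes under the Hodge conjecture.** If the Hodge conjecture holds, then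
for every morphism `f : X ⟶ B` of smooth projective varieties with `dim X < dim B + p` every rational
`(p,p)`-class on `X` dies on `X ∖ f⁻¹T` for some proper Zariski-closed `T ⊊ B` — for `p ≥ 2`, on a
neighbourhood of the generic fibre of every fibration of `X` in curves over an `(n-1)`-fold.
[cite: GrothendieckTopology1969, pp. 300–301] -/
theorem soloInformed_verticalSupport_of_hodgeConjecture (h : _root_.HodgeConjecture)
    (hX : Motives.IsSmoothProjective n X) (hB : Motives.IsSmoothProjective m B) (f : X ⟶ B)
    {p : ℕ} (hnmp : n < m + p) (c : complexBetti X (2 * p)) (hc : IsRationalClass c)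
    (hc' : IsOfHodgeType n X (2 * p) p p c) :
    ∃ T : Set B.left, IsClosed T ∧ T ≠ Set.univ ∧
      complexBetti.restrictCompl X (f.left.base ⁻¹' T) (2 * p) c = 0 :=
  soloInformed_verticalSupport_of_mem_algebraicClasses hX hB f hnmp ((h hX).2 p c hc hc')

/-- **Vertical support is coniveau `≥ 1`**: if `f : X ⟶ B` is surjective on points and `c` dies off
`f⁻¹T` for a proper closed `T ⊊ B`, then `c ∈ N¹` (`f⁻¹T` is a proper closed subset of `X`).
[cite: GrothendieckTopology1969, §1] -/
theorem soloInformed_coniveauOne_of_verticalSupport (hX : Motives.IsSmoothProjective n X)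
    (f : X ⟶ B) (hf : Function.Surjective f.left.base) {k : ℕ} {c : complexBetti X k}
    {T : Set B.left} (hT : IsClosed T) (hT' : T ≠ Set.univ)
    (hc : complexBetti.restrictCompl X (f.left.base ⁻¹' T) k c = 0) :
    c ∈ supportedClasses X k 1 := by
  have hpre : f.left.base ⁻¹' T ≠ Set.univ := by
    intro h'
    apply hT'
    rw [Set.eq_univ_iff_forall] at h' ⊢
    intro x
    obtain ⟨z, rfl⟩ := hf x
    exact h' z
  exact mem_supportedClasses_of_restrictCompl_eq_zero (hT.preimage f.left.base.hom.continuous)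
    (fun z hz ↦ one_le_coheight_of_mem_of_isClosed hX (hT.preimage f.left.base.hom.continuous) hpre hz)
    hc

/-- **The fibration form of the Hodge conjecture.** Granted the named facts of
`SoloInformedConiveauOne` (Deligne 8.2.8, the semisimplicity lift, Gysin images vs. restriction,
projective Hironaka, Lefschetz `(1,1)`, Hodge models), `HodgeConjecture` holds iff for every smooth
projective `n`-fold `X`, every `2 ≤ p ≤ n/2`, every rational `(p,p)`-class `c` on `X` and every
morphism `f : X ⟶ B` to a smooth projective `m`-fold with `n < m + p`, the class `c` dies off the
preimage of a proper Zariski-closed subset of `B`. (`f = 𝟙 X` is allowed and gives `C1`; the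
necessity for all other `f` — verticality for every curve fibration over an `(n-1)`-fold — is the
content.) [cite: GrothendieckTopology1969, pp. 300–301] [cite: VoisinHodgeII2003, Ch. 8] -/
theorem soloInformed_hodgeConjecture_iff_verticalSupport
    (hA : Deligne1974_ker_restrictCompl_eq_iSup_range_complexGysin)
    (hB : Voisin2025_hodgeClass_lift_complexGysin)
    (hS : gysinMap_restrictCompl_eq_zero.{0, 0} ℂ)
    (hH : Resolution.Hironaka1964_projective.{0})
    (hL : lefschetzOneOne_rational)
    (hM : ∀ (n : ℕ) (X : Motives.SchemeOver ℂ), nonempty_hodgeModel n X) :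
    _root_.HodgeConjecture ↔
      ∀ ⦃n : ℕ⦄ ⦃X : Motives.SchemeOver ℂ⦄, Motives.IsSmoothProjective n X →
        ∀ (p : ℕ) (c : complexBetti X (2 * p)), 2 ≤ p → 2 * p ≤ n → IsRationalClass c →
          IsOfHodgeType n X (2 * p) p p c →
          ∀ ⦃m : ℕ⦄ ⦃B : Motives.SchemeOver ℂ⦄, Motives.IsSmoothProjective m B →
            ∀ f : X ⟶ B, n < m + p →
              ∃ T : Set B.left, IsClosed T ∧ T ≠ Set.univ ∧
                complexBetti.restrictCompl X (f.left.base ⁻¹' T) (2 * p) c = 0 := by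
  constructor
  · intro h n X hX p c _ _ hc hc' m B hB f hnmp
    exact soloInformed_verticalSupport_of_hodgeConjecture h hX hB f hnmp c hc hc'
  · intro h
    refine soloInformed_hodgeConjecture_of_coniveauOne hA hB hS hH hL hM ?_
    intro n X hX p c hp hpn hc hc'
    obtain ⟨T, hT, hT', hcT⟩ := h hX p c hp hpn hc hc' hX (𝟙 X) (by omega)
    refine soloInformed_coniveauOne_of_verticalSupport hX (𝟙 X) ?_ hT hT' hcT
    intro x
    exact ⟨x, by simp⟩

end Summit.HodgeConjecture.HodgeConjecture.Theorems
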